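import Summits.CriticalPhenomena.PercolationContinuityZ3.Theorems.PercNearOneGluingNoHeavyLowerTailGeometricMomentCIL
import HarnessLib

/-!
# `NoHeavyLowerTail` (stmt-CriticalPhenomena-4575) — the geometric-moment CIL may have a constant GROWING with the
# number of hot relays `m ≥ |A|·(1 − v)` (subexponentially), in the near-one regime, with observer and pair budgets

Support file (lead gen 5; `--supports stmt-CriticalPhenomena-4575`).  No definitions, no named facts, no sorries.
Notation as in `…GeometricMomentCIL.lean`: `L(v) = Σ_{j≥1} v^j P(N=j)`, `R_a(v) = Σ_{j≥0} v^j P(|π(a)|=j)`, `k = |A|`.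

WHY.  In the one-cut reduction the hypothesis is only ever evaluated at `v = s^{1/⌊k/4⌋}`, i.e. at `1 − v ≈ (4/k)·log(1/s)`:
in the virtual-star-sink picture (`b` joined to every relay with weight `q = 1 − v`) the sink has only
`m := q·k ≈ 4 log(1/s)` "hot" relays ON AVERAGE, a number fixed by `ε` and independent of `k`.  Hence a constant that
grows with `m` — polynomially, or even like `e^{m/8 − o(m)}` — is still admissible: the window height `s = e^{−m/8}` beats it.
This is the natural loss of arguments that pay per hot relay (union bounds over the glued target, inductions on `|H|`).

* `noHeavyLowerTail_of_geometricMomentCIL_growing` — fix ANY `τ₀ > 0` and ANY `C : ℕ → ℝ≥0` with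
  `∀ ε > 0 ∃ m ≥ 1, (C m + 1)·e^{−m/8} ≤ ε` (true whenever `C m = e^{o(m)}`, e.g. `C m = C₀ (1+m)^p`); it suffices that
  every graph IN THE REGIME `{P(a ↮ a') ≤ τ' ≤ τ₀ ∀ a,a' ∈ A, P(o ↮ A) ≤ τ₀}` admits, for every `v ∈ (0,1]` and every
  integer `m ≥ k(1 − v)`, a relay `a ∈ A` with  `L(v) ≤ C m · (R_a(v) + P(o ↮ A) + τ')`.
* `GeomMomentCIL.poly_growth` — polynomial constants satisfy the growth condition;
  `noHeavyLowerTail_of_geometricMomentCIL_poly` — the socket with `C m = C₀ (m+1)^p`.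
-/

noncomputable section

namespace Summit.CriticalPhenomena.PercolationContinuityZ3.Theorems

open MeasureTheory Set Literature.Probability.LatticeModels Literature.Probability.Percolation
open Summit.CriticalPhenomena.PercolationContinuityZ3.Theses.PercNearOneGluing
open scoped Classical BigOperators

open GeomMomentCIL in
/-- **Geometric-moment CIL with a constant subexponential in the number of hot relays `m ≥ |A|(1−v)`, in the near-one
regime, with the observer budget `P(o ↮ A)` and a pairwise budget `τ'` on the right ⇒ `NoHeavyLowerTail`.**
Proof: as `noHeavyLowerTail_of_geometricMomentCIL`, but with `s := e^{−m/8}` for the `m` supplied by the growth hypothesis at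
`ε/4`, and `v := e^{−m/(8J)}` (`J = ⌊k/4⌋`), so that `v^J = s` and `k(1 − v) ≤ k·m/(8J) ≤ m` (`k ≤ 8⌊k/4⌋` for `k ≥ 4`).
[this work] -/
theorem noHeavyLowerTail_of_geometricMomentCIL_growing (C : ℕ → ℝ) (τ₀ : ℝ) (hC : ∀ m, 0 ≤ C m) (hτ₀ : 0 < τ₀)
    (hgrowth : ∀ ε : ℝ, 0 < ε → ∃ m : ℕ, 1 ≤ m ∧ (C m + 1) * Real.exp (-(m : ℝ) / 8) ≤ ε)
    (hGM : ∀ (n : ℕ) (w : Sym2 (Fin n) → unitInterval) (A : Finset (Fin n)) (o : Fin n) (v τ' : ℝ) (m : ℕ),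
      0 < v → v ≤ 1 → A.Nonempty → o ∉ A → (A.card : ℝ) * (1 - v) ≤ m → 0 ≤ τ' → τ' ≤ τ₀ →
      (∀ a ∈ A, ∀ a' ∈ A, (prodBernoulli w).real (openConn a a' : Set (BondConfig (Fin n)))ᶜ ≤ τ') →
      (prodBernoulli w).real (⋃ a ∈ A, (openConn o a : Set (BondConfig (Fin n))))ᶜ ≤ τ₀ →
      ∃ a ∈ A,
        ∑ j ∈ Finset.Icc 1 A.card, v ^ j * (prodBernoulli w).real {ω : BondConfig (Fin n) |
            (A.filter fun x => ω ∈ openConn o x).card = j} ≤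
          C m * (∑ j ∈ Finset.range (A.card + 1), v ^ j * (prodBernoulli w).real {ω : BondConfig (Fin n) |
            (A.filter fun x => ω ∈ openConn a x).card = j} +
            (prodBernoulli w).real (⋃ a ∈ A, (openConn o a : Set (BondConfig (Fin n))))ᶜ + τ')) :
    Summit.CriticalPhenomena.PercolationContinuityZ3.Theses.PercNearOneGluing.NoHeavyLowerTail := by
  refine noHeavyLowerTail_of_oneCut_modulus fun ε hε => ?_
  -- the number of hot relays `m` and the window height `s = e^{-m/8}`
  obtain ⟨m, hm1, hm⟩ := hgrowth (ε / 4) (by linarith)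
  set s : ℝ := Real.exp (-(m : ℝ) / 8) with hsdef
  have hs0 : 0 < s := Real.exp_pos _
  have hs1 : s ≤ 1 := by
    rw [hsdef]; apply Real.exp_le_one_iff.2
    have : (0 : ℝ) ≤ m := Nat.cast_nonneg m
    linarith
  set C₁ : ℝ := max (C m) 1 with hC₁def
  have hC₁1 : 1 ≤ C₁ := le_max_right _ _
  have hC₁0 : 0 < C₁ := by linarith
  have hCC₁ : C m ≤ C₁ := le_max_left _ _
  have hC₁s : C₁ * s ≤ ε / 4 := by
    -- `max (C m) 1 · s ≤ (C m + 1) · s ≤ ε/4`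
    have h1 : C₁ ≤ C m + 1 := max_le (by linarith) (by linarith [hC m])
    calc C₁ * s ≤ (C m + 1) * s := mul_le_mul_of_nonneg_right h1 hs0.le
      _ ≤ ε / 4 := hm
  -- budget
  set τ₁ : ℝ := ε * s / (16 * C₁) with hτ₁def
  have hτ₁0 : 0 < τ₁ := by positivity
  set τ : ℝ := min τ₀ τ₁ with hτdef
  have hτ0 : 0 < τ := lt_min hτ₀ hτ₁0
  have hττ₀ : τ ≤ τ₀ := min_le_left _ _
  have hττ₁ : τ ≤ τ₁ := min_le_right _ _
  have hτε : 2 * τ ≤ ε := by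
    have h1 : ε * s ≤ ε * (8 * C₁) := by nlinarith
    have h2 : 2 * τ₁ = ε * s / (8 * C₁) := by rw [hτ₁def]; ring
    have h3 : 2 * τ₁ ≤ ε := by rw [h2, div_le_iff₀ (by positivity)]; exact h1
    linarith
  refine ⟨1 / 4, τ, by norm_num, hτ0, fun n w A o hpair hU => ?_⟩
  set μ := prodBernoulli w with hμ
  have hpair' : ∀ a ∈ A, ∀ a' ∈ A, μ.real (openConn a a' : Set (BondConfig (Fin n)))ᶜ ≤ τ := by
    intro a ha a' ha'
    by_cases h : a = a'
    · subst h; exact measureReal_compl_openConn_self_le w a hτ0.le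
    · exact hpair a ha a' ha' h
  have hU₀ : μ.real (⋃ a ∈ A, (openConn o a : Set (BondConfig (Fin n))))ᶜ ≤ τ₀ := hU.trans hττ₀
  have hEN : ∑ a ∈ A, μ.real (openConn o a : Set (BondConfig (Fin n))) ≤ A.card := by
    calc ∑ a ∈ A, μ.real (openConn o a : Set (BondConfig (Fin n))) ≤ ∑ a ∈ A, (1 : ℝ) :=
          Finset.sum_le_sum fun a _ => measureReal_le_one
      _ = A.card := by simp
  set J : ℕ := A.card / 4 with hJdef
  set T : Set (BondConfig (Fin n)) := {ω : BondConfig (Fin n) |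
      1 ≤ (A.filter fun x => ω ∈ openConn o x).card ∧
        (A.filter fun x => ω ∈ openConn o x).card ≤ J} with hTdef
  have hsub : {ω : BondConfig (Fin n) | 1 ≤ (A.filter fun a => ω ∈ openConn o a).card ∧
        ((A.filter fun a => ω ∈ openConn o a).card : ℝ) <
          1 / 4 * (∑ a ∈ A, μ.real (openConn o a : Set (BondConfig (Fin n))))} ⊆ T := by
    intro ω hω
    simp only [Set.mem_setOf_eq] at hω
    refine ⟨hω.1, ?_⟩
    have hlt : ((A.filter fun a => ω ∈ openConn o a).card : ℝ) < 1 / 4 * (A.card : ℝ) :=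
      lt_of_lt_of_le hω.2 (by nlinarith)
    have h4 : (4 * (A.filter fun a => ω ∈ openConn o a).card : ℕ) < A.card := by
      have : (4 : ℝ) * ((A.filter fun a => ω ∈ openConn o a).card : ℝ) < (A.card : ℝ) := by linarith
      exact_mod_cast this
    rw [hJdef]; omega
  refine (measureReal_mono hsub (measure_ne_top _ _)).trans ?_
  by_cases hJ0 : J = 0
  · have hT : T = ∅ := by
      ext ω; simp only [hTdef, Set.mem_setOf_eq, Set.mem_empty_iff_false, iff_false, not_and, not_le]
      intro h1; omega
    rw [hT, measureReal_empty]; exact hε.le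
  have hJ1 : 1 ≤ J := Nat.one_le_iff_ne_zero.2 hJ0
  have hAcard : 4 ≤ A.card := by rw [hJdef] at hJ1; omega
  have hAne : A.Nonempty := Finset.card_pos.1 (by omega)
  by_cases ho : o ∈ A
  · have hT2 : T ⊆ {ω : BondConfig (Fin n) | 2 * (A.filter fun a' => ω ∈ openConn o a').card ≤ A.card} := by
      intro ω hω
      simp only [hTdef, Set.mem_setOf_eq] at hω ⊢
      rw [hJdef] at hω; omega
    calc μ.real T ≤ μ.real {ω : BondConfig (Fin n) |
          2 * (A.filter fun a' => ω ∈ openConn o a').card ≤ A.card} :=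
          measureReal_mono hT2 (measure_ne_top _ _)
      _ ≤ 2 * τ := smallBlock_le_two_mul w A o τ ho (hpair' o ho)
      _ ≤ ε := hτε
  -- `v := e^{-m/(8J)}`, so that `v^J = s` and `k (1 - v) ≤ m`
  have hJpos : (0 : ℝ) < J := by exact_mod_cast hJ1
  set x : ℝ := (m : ℝ) / (8 * J) with hxdef
  have hx0 : 0 ≤ x := by positivity
  set v : ℝ := Real.exp (-x) with hvdef
  have hv0 : 0 < v := Real.exp_pos _
  have hv1 : v ≤ 1 := by rw [hvdef]; exact Real.exp_le_one_iff.2 (by linarith)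
  have hvJ : v ^ J = s := by
    rw [hvdef, hsdef, ← Real.exp_nat_mul]
    congr 1
    rw [hxdef]; field_simp
  have h1v : 1 - v ≤ x := by
    have := Real.add_one_le_exp (-x)
    rw [hvdef]; linarith
  have hk8J : (A.card : ℝ) ≤ 8 * J := by
    have : A.card ≤ 8 * J := by rw [hJdef]; omega
    exact_mod_cast this
  have hkm : (A.card : ℝ) * (1 - v) ≤ m := by
    have hm0 : (0 : ℝ) ≤ m := Nat.cast_nonneg m
    calc (A.card : ℝ) * (1 - v) ≤ (8 * J) * x :=
          mul_le_mul hk8J h1v (by linarith) (by positivity)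
      _ = m := by rw [hxdef]; field_simp
  obtain ⟨a, ha, hle⟩ := hGM n w A o v τ m hv0 hv1 hAne ho hkm hτ0.le hττ₀ hpair' hU₀
  have hlow := pow_mul_window_le_momentSum μ (fun ω => (A.filter fun x => ω ∈ openConn o x).card)
    v hv0.le hv1 J A.card (Nat.div_le_self _ _)
  set h : ℕ := A.card / 2 + 1 with hhdef
  have hup := momentSum_le_small_add_pow μ (fun ω => (A.filter fun x => ω ∈ openConn a x).card)
    v hv0.le hv1 A.card h
  have hsmall : μ.real {ω : BondConfig (Fin n) | (A.filter fun x => ω ∈ openConn a x).card < h} ≤ 2 * τ := by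
    have heq : {ω : BondConfig (Fin n) | (A.filter fun x => ω ∈ openConn a x).card < h} =
        {ω : BondConfig (Fin n) | 2 * (A.filter fun a' => ω ∈ openConn a a').card ≤ A.card} := by
      ext ω; simp only [Set.mem_setOf_eq, hhdef]; omega
    rw [heq]
    exact smallBlock_le_two_mul w A a τ ha (hpair' a ha)
  have hvh : v ^ h ≤ s * s := by
    have h2J : 2 * J ≤ h := by rw [hhdef, hJdef]; omega
    calc v ^ h ≤ v ^ (2 * J) := pow_le_pow_of_le_one hv0.le hv1 h2J
      _ = s * s := by rw [pow_mul', hvJ, sq]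
  have hchain : s * μ.real T ≤ C m * (2 * τ + s * s + τ + τ) := by
    have e1 : v ^ J * μ.real T ≤ C m * (μ.real {ω : BondConfig (Fin n) |
        (A.filter fun x => ω ∈ openConn a x).card < h} + v ^ h +
          μ.real (⋃ a ∈ A, (openConn o a : Set (BondConfig (Fin n))))ᶜ + τ) := by
      refine (hlow.trans hle).trans (mul_le_mul_of_nonneg_left ?_ (hC m))
      linarith [hup]
    rw [hvJ] at e1
    refine e1.trans (mul_le_mul_of_nonneg_left ?_ (hC m))
    linarith [hsmall, hvh, hU]
  have hkey : C m * (2 * τ + s * s + τ + τ) ≤ s * (ε / 2) := by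
    have h4τ : 4 * τ₁ = ε * s / (4 * C₁) := by rw [hτ₁def]; ring
    have hb0 : 0 ≤ 2 * τ + s * s + τ + τ := by positivity
    calc C m * (2 * τ + s * s + τ + τ) ≤ C₁ * (2 * τ + s * s + τ + τ) := mul_le_mul_of_nonneg_right hCC₁ hb0
      _ ≤ C₁ * (4 * τ₁ + s * s) := by
          refine mul_le_mul_of_nonneg_left ?_ hC₁0.le; linarith
      _ = ε * s / 4 + (C₁ * s) * s := by rw [h4τ]; field_simp
      _ ≤ ε * s / 4 + (ε / 4) * s := by nlinarith [hC₁s, hs0.le]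
      _ = s * (ε / 2) := by ring
  have hfin : μ.real T ≤ ε / 2 := le_of_mul_le_mul_left (hchain.trans hkey) hs0
  linarith

/-- Polynomial growth is subexponential: for `C₀ ≥ 0` and `p : ℕ`, `∀ ε > 0 ∃ m ≥ 1, (C₀ (m+1)^p + 1)·e^{−m/8} ≤ ε`.
[folklore; from `Real.tendsto_pow_mul_exp_neg_atTop_nhds_zero`] -/
theorem GeomMomentCIL.poly_growth (C₀ : ℝ) (p : ℕ) :
    ∀ ε : ℝ, 0 < ε → ∃ m : ℕ, 1 ≤ m ∧ (C₀ * ((m : ℝ) + 1) ^ p + 1) * Real.exp (-(m : ℝ) / 8) ≤ ε := by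
  intro ε hε
  -- `y := (m+1)/8 → ∞`, and `(m+1)^p e^{-m/8} = e^{1/8} 8^p · y^p e^{-y}`
  have hy : Filter.Tendsto (fun m : ℕ => ((m : ℝ) + 1) / 8) Filter.atTop Filter.atTop := by
    refine Filter.tendsto_atTop_atTop.2 fun b => ⟨⌈8 * |b|⌉₊, fun m hm => ?_⟩
    have h1 : (8 * |b| : ℝ) ≤ m := (Nat.le_ceil _).trans (by exact_mod_cast hm)
    have h2 : b ≤ |b| := le_abs_self b
    rw [le_div_iff₀ (by norm_num : (0:ℝ) < 8)]
    linarith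
  have h1 : Filter.Tendsto (fun m : ℕ => (((m : ℝ) + 1) / 8) ^ p * Real.exp (-(((m : ℝ) + 1) / 8)))
      Filter.atTop (nhds 0) :=
    (Real.tendsto_pow_mul_exp_neg_atTop_nhds_zero p).comp hy
  have h2 : Filter.Tendsto (fun m : ℕ => Real.exp (-(((m : ℝ) + 1) / 8))) Filter.atTop (nhds 0) :=
    Real.tendsto_exp_neg_atTop_nhds_zero.comp hy
  have h3 : Filter.Tendsto (fun m : ℕ =>
      (C₀ * Real.exp (1 / 8) * 8 ^ p) * ((((m : ℝ) + 1) / 8) ^ p * Real.exp (-(((m : ℝ) + 1) / 8))) +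
        Real.exp (1 / 8) * Real.exp (-(((m : ℝ) + 1) / 8))) Filter.atTop (nhds 0) := by
    have := (h1.const_mul (C₀ * Real.exp (1 / 8) * 8 ^ p)).add (h2.const_mul (Real.exp (1 / 8)))
    simpa using this
  have h4 : Filter.Tendsto (fun m : ℕ => (C₀ * ((m : ℝ) + 1) ^ p + 1) * Real.exp (-(m : ℝ) / 8))
      Filter.atTop (nhds 0) := by
    refine h3.congr fun m => ?_
    have he : Real.exp (1 / 8) * Real.exp (-(((m : ℝ) + 1) / 8)) = Real.exp (-(m : ℝ) / 8) := by
      rw [← Real.exp_add]; congr 1; ring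
    have hp : (8 : ℝ) ^ p * (((m : ℝ) + 1) / 8) ^ p = ((m : ℝ) + 1) ^ p := by
      rw [← mul_pow]; congr 1; ring
    calc (C₀ * Real.exp (1 / 8) * 8 ^ p) * ((((m : ℝ) + 1) / 8) ^ p * Real.exp (-(((m : ℝ) + 1) / 8))) +
          Real.exp (1 / 8) * Real.exp (-(((m : ℝ) + 1) / 8))
        = C₀ * ((8 : ℝ) ^ p * (((m : ℝ) + 1) / 8) ^ p) * (Real.exp (1 / 8) * Real.exp (-(((m : ℝ) + 1) / 8))) +
          Real.exp (1 / 8) * Real.exp (-(((m : ℝ) + 1) / 8)) := by ring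
      _ = (C₀ * ((m : ℝ) + 1) ^ p + 1) * Real.exp (-(m : ℝ) / 8) := by rw [hp, he]; ring
  have hev : ∀ᶠ m : ℕ in Filter.atTop,
      (C₀ * ((m : ℝ) + 1) ^ p + 1) * Real.exp (-(m : ℝ) / 8) ≤ ε ∧ 1 ≤ m :=
    (h4.eventually (Iic_mem_nhds hε)).and (Filter.eventually_ge_atTop 1)
  obtain ⟨m, hmε, hm1⟩ := hev.exists
  exact ⟨m, hm1, hmε⟩

open GeomMomentCIL in
/-- **Geometric-moment CIL with a constant POLYNOMIAL in the number of hot relays ⇒ `NoHeavyLowerTail`.**  Fix any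
`τ₀ > 0`, `C₀ ≥ 0`, `p : ℕ`; it suffices that every graph in the regime `{P(a ↮ a') ≤ τ' ≤ τ₀, P(o ↮ A) ≤ τ₀}` admits,
for every `v ∈ (0,1]` and every integer `m ≥ |A|(1 − v)`, a relay `a ∈ A` with
`L(v) ≤ C₀ (m+1)^p · (R_a(v) + P(o ↮ A) + τ')`. [this work] -/
theorem noHeavyLowerTail_of_geometricMomentCIL_poly (C₀ τ₀ : ℝ) (p : ℕ) (hC₀ : 0 ≤ C₀) (hτ₀ : 0 < τ₀)
    (hGM : ∀ (n : ℕ) (w : Sym2 (Fin n) → unitInterval) (A : Finset (Fin n)) (o : Fin n) (v τ' : ℝ) (m : ℕ),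
      0 < v → v ≤ 1 → A.Nonempty → o ∉ A → (A.card : ℝ) * (1 - v) ≤ m → 0 ≤ τ' → τ' ≤ τ₀ →
      (∀ a ∈ A, ∀ a' ∈ A, (prodBernoulli w).real (openConn a a' : Set (BondConfig (Fin n)))ᶜ ≤ τ') →
      (prodBernoulli w).real (⋃ a ∈ A, (openConn o a : Set (BondConfig (Fin n))))ᶜ ≤ τ₀ →
      ∃ a ∈ A,
        ∑ j ∈ Finset.Icc 1 A.card, v ^ j * (prodBernoulli w).real {ω : BondConfig (Fin n) |
            (A.filter fun x => ω ∈ openConn o x).card = j} ≤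
          (C₀ * ((m : ℝ) + 1) ^ p) * (∑ j ∈ Finset.range (A.card + 1), v ^ j * (prodBernoulli w).real
            {ω : BondConfig (Fin n) | (A.filter fun x => ω ∈ openConn a x).card = j} +
            (prodBernoulli w).real (⋃ a ∈ A, (openConn o a : Set (BondConfig (Fin n))))ᶜ + τ')) :
    Summit.CriticalPhenomena.PercolationContinuityZ3.Theses.PercNearOneGluing.NoHeavyLowerTail :=
  noHeavyLowerTail_of_geometricMomentCIL_growing (fun m => C₀ * ((m : ℝ) + 1) ^ p) τ₀
    (fun m => by positivity) hτ₀ (poly_growth C₀ p) hGM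

end Summit.CriticalPhenomena.PercolationContinuityZ3.Theorems

end
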